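import Summits.QuantumFields.YangMills.Theorems.UV3AxialLaunderingOverwrite
import HarnessLib

/-!
# R3 (cell `ym3-torus`, YM₃ on T³ — a ladder RUNG, NOT d = 4, NOT infinite volume, NOT a mass gap, NOT the Clay problem) —
# **THE FRESH OVERWRITE ITERATES: the image law is again shear-invariant on its laundered coordinates, and the shear hypothesis is produced
# by product Haar, by slot-blind densities and events, and by pushforwards intertwining the shear**

Width seat `ym-ust-19936-w8` g12 on crux `stmt-QuantumFields-19936` `UnitScaleTilt.HistoryTailL` (`--supports`, helper; THEOREMS ONLY, 0 `def`, 0 `sorry`).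
RECORD CURRENCY (★★OWNER WORDS 84 (2) ∕ 85 (4)): record-independent kinematics of product Haar and the straight transporter — SUPPLY-side tooling for the hTop-class
(47)∕(55) rows `fibre55Win` ∕ `fibre57LowOn` of the χ record `AlphaInputsT3ACv4RecChi` inside NODE O B3 and for Track A's N08; NOT a row of the 19936 registry.
Sequel of ✓`UV3AxialLaunderingOverwrite` (p757085) (the overwrite formula `ν.map Φ = (ν ⊗ dU_{j+1}).map ((U, k) ↦ Λ.piecewise k (Φ U))` for a law `ν` invariant under the
`Λ`-masked slot shear and a map `Φ` axial on `Λ`).  For the cross-level bookkeeping of hTop (`N08-HJ-LOOPPART-DESIGN-g47.md` §2, (M4)∕(M5)) the invariance must be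
AVAILABLE at every level: §1 shows it is REPRODUCED on the image (the laundered coordinates of `ν.map Φ` can be right-multiplied by anything), §2 lists the producers at
the bottom level and along densities ∕ restrictions ∕ intertwined pushforwards (e.g. `(Ū^S)_*`, whose unguarded coordinates turn the previous level's last-bond shear into
the slot shear, lit `AveragingRT.axialAvg_mul_last`).

CONTENTS.  §1 ★★ `map_map_mulRight_mask_eq` — `(ν.map Φ).map (V ↦ V·(Λ.mulIndicator g)) = ν.map Φ`.  §2 `map_withDensity_eq_of_map_eq`, `map_restrict_eq_of_map_eq`,
`map_map_eq_of_semiconj` (generic), `map_shear_mask_fieldMeasure` (product Haar).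

HONEST SCOPE.  [folklore] measure theory on the lit objects `AveragingRT.axialAvg`∕`line`∕`fieldMeasure`; N08-vocabulary-free; a TOOL for (M4)∕(M5), not (M4); hTop,
(a)′∀, hJ, `stub_hJ`, `stub_laneRecordsV3`, `HistoryTailL` (19936), the rung `YM3TorusSU2`, any continuum limit, d = 4, a mass gap or Clay are NOT proved here.
YM₃ on T³ is rung R3 of the ladder, not the Clay problem.

References: T. Bałaban, Commun. Math. Phys. **98** (1985) 17–51 [Balaban1985Averaging] ((10) p. 19 product Haar `dU`, (b) p. 23 Haar compatibility); T. Bałaban,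
Commun. Math. Phys. **109** (1987) 249–301 [Balaban1987RG1] ((0.4) p. 253).
-/

set_option autoImplicit false

noncomputable section

open MeasureTheory
open scoped ENNReal

namespace Summit.QuantumFields.YangMills.Theorems.UV3AxialLaunderingOverwritePropagate

open Literature.MathematicalPhysics.QuantumFieldTheory.Balaban1983to89
open Literature.MathematicalPhysics.QuantumFieldTheory.Balaban1983to89.AveragingRT
open Summit.QuantumFields.YangMills.Theorems.UV3AxialLaunderingFreeSlot
open Summit.QuantumFields.YangMills.Theorems.UV3AxialLaunderingOverwrite

/-! ## §1 Freshness propagates: the image law is invariant under right-multiplying its `Λ`-coordinates -/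
section Propagate

variable {P : Params} {j : ℕ} {G : Type*} [GaugeGroup G] [MeasurableSpace G] [HaarData G] [MeasurableMul₂ G]
  (hj : j + 1 ≤ P.m + P.K) (t : PBond P (j + 1) → ℕ) (ht : ∀ c, t c < P.L) (Λ : Set (PBond P (j + 1))) [DecidablePred (· ∈ Λ)]
  {Φ : GaugeField P j G → GaugeField P (j + 1) G} (hΦ : Measurable Φ) (hΦΛ : ∀ U, ∀ c ∈ Λ, Φ U c = axialAvg U c)
  (hΦoff : ∀ U U' : GaugeField P j G, (∀ b, (¬ ∃ c ∈ Λ, line c (t c) = b) → U b = U' b) → ∀ c, c ∉ Λ → Φ U c = Φ U' c)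

include hj ht hΦ hΦΛ hΦoff

/-- ★★ **FRESHNESS PROPAGATES ONE LEVEL UP**: under the hypotheses of `map_eq_overwrite`, the image law `ν.map Φ` is invariant under right-multiplication of its
`Λ`-coordinates by an arbitrary coarse field, `(ν.map Φ).map (V ↦ V·(Λ.mulIndicator g)) = ν.map Φ` — the NEXT level's shear hypothesis on every segment whose slot lies
in `Λ` (a field that is `1` off `Λ` is `Λ.mulIndicator` of itself). [cite: Balaban1985Averaging, (10) p.19 and (b) p.23] -/
theorem map_map_mulRight_mask_eq (ν : Measure (GaugeField P j G)) [SFinite ν]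
    (hν : ∀ k : GaugeField P (j + 1) G,
      ν.map (fun U b => U b * Function.extend (fun c : PBond P (j + 1) => line c (t c)) (Λ.mulIndicator k) (fun _ => 1) b) = ν)
    (g : GaugeField P (j + 1) G) :
    (ν.map Φ).map (fun (V : GaugeField P (j + 1) G) (c : PBond P (j + 1)) => V c * Λ.mulIndicator g c) = ν.map Φ := by
  have hover : @Measurable (GaugeField P j G × GaugeField P (j + 1) G) (GaugeField P (j + 1) G) _ _
      fun p => Λ.piecewise p.2 (Φ p.1) :=
    measurable_piecewise_overwrite Λ (hΦ.comp measurable_fst) measurable_snd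
  have hR : MeasurePreserving (fun (V : GaugeField P (j + 1) G) (c : PBond P (j + 1)) => V c * Λ.mulIndicator g c)
      (fieldMeasure P (j + 1) G) (fieldMeasure P (j + 1) G) := measurePreserving_mulRight _
  have hRg : MeasurePreserving (fun (k : GaugeField P (j + 1) G) (c : PBond P (j + 1)) => k c * g c)
      (fieldMeasure P (j + 1) G) (fieldMeasure P (j + 1) G) := measurePreserving_mulRight _
  -- the composite is the overwrite by `k·g`
  have hcomp : ((fun (V : GaugeField P (j + 1) G) (c : PBond P (j + 1)) => V c * Λ.mulIndicator g c) ∘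
        fun p : GaugeField P j G × GaugeField P (j + 1) G => (Λ.piecewise p.2 (Φ p.1) : GaugeField P (j + 1) G)) =
      (fun p : GaugeField P j G × GaugeField P (j + 1) G => (Λ.piecewise p.2 (Φ p.1) : GaugeField P (j + 1) G)) ∘
        Prod.map id (fun (k : GaugeField P (j + 1) G) (c : PBond P (j + 1)) => k c * g c) := by
    funext p
    obtain ⟨U, k⟩ := p
    funext c
    show Λ.piecewise k (Φ U) c * Λ.mulIndicator g c = Λ.piecewise (fun c => k c * g c) (Φ U) c
    by_cases hc : c ∈ Λ
    · rw [Set.piecewise_eq_of_mem _ _ _ hc, Set.piecewise_eq_of_mem _ _ _ hc, Set.mulIndicator_of_mem hc]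
    · rw [Set.piecewise_eq_of_notMem _ _ _ hc, Set.piecewise_eq_of_notMem _ _ _ hc, Set.mulIndicator_of_notMem hc, mul_one]
  have hprod := congrArg₂ (fun (μ₁ : Measure (GaugeField P j G)) (μ₂ : Measure (GaugeField P (j + 1) G)) => μ₁.prod μ₂)
    (Measure.map_id (μ := ν)) hRg.map_eq
  calc (ν.map Φ).map (fun (V : GaugeField P (j + 1) G) (c : PBond P (j + 1)) => V c * Λ.mulIndicator g c)
      = (((ν.prod (fieldMeasure P (j + 1) G)).map
          (fun p : GaugeField P j G × GaugeField P (j + 1) G => (Λ.piecewise p.2 (Φ p.1) : GaugeField P (j + 1) G))) :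
            Measure (GaugeField P (j + 1) G)).map
          (fun (V : GaugeField P (j + 1) G) (c : PBond P (j + 1)) => V c * Λ.mulIndicator g c) :=
        congrArg (fun μ : Measure (GaugeField P (j + 1) G) =>
          (μ.map fun (V : GaugeField P (j + 1) G) (c : PBond P (j + 1)) => V c * Λ.mulIndicator g c))
          (map_eq_overwrite hj t ht Λ hΦ hΦΛ hΦoff ν hν)
    _ = ((ν.prod (fieldMeasure P (j + 1) G)).map
          (((fun (V : GaugeField P (j + 1) G) (c : PBond P (j + 1)) => V c * Λ.mulIndicator g c) ∘
            fun p : GaugeField P j G × GaugeField P (j + 1) G => (Λ.piecewise p.2 (Φ p.1) : GaugeField P (j + 1) G))) :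
              Measure (GaugeField P (j + 1) G)) :=
        Measure.map_map hR.measurable hover
    _ = ((ν.prod (fieldMeasure P (j + 1) G)).map
          ((fun p : GaugeField P j G × GaugeField P (j + 1) G => (Λ.piecewise p.2 (Φ p.1) : GaugeField P (j + 1) G)) ∘
            Prod.map id (fun (k : GaugeField P (j + 1) G) (c : PBond P (j + 1)) => k c * g c)) :
              Measure (GaugeField P (j + 1) G)) :=
        congrArg (fun f : GaugeField P j G × GaugeField P (j + 1) G → GaugeField P (j + 1) G =>
          ((ν.prod (fieldMeasure P (j + 1) G)).map f : Measure (GaugeField P (j + 1) G))) hcomp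
    _ = (((ν.prod (fieldMeasure P (j + 1) G)).map
          (Prod.map id (fun (k : GaugeField P (j + 1) G) (c : PBond P (j + 1)) => k c * g c))).map
          (fun p : GaugeField P j G × GaugeField P (j + 1) G => (Λ.piecewise p.2 (Φ p.1) : GaugeField P (j + 1) G)) :
            Measure (GaugeField P (j + 1) G)) :=
        (Measure.map_map hover (measurable_id.prodMap hRg.measurable)).symm
    _ = (((ν.map id).prod (((fieldMeasure P (j + 1) G).map
          fun (k : GaugeField P (j + 1) G) (c : PBond P (j + 1)) => k c * g c) : Measure (GaugeField P (j + 1) G))).map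
          (fun p : GaugeField P j G × GaugeField P (j + 1) G => (Λ.piecewise p.2 (Φ p.1) : GaugeField P (j + 1) G)) :
            Measure (GaugeField P (j + 1) G)) :=
        congrArg (fun μ : Measure (GaugeField P j G × GaugeField P (j + 1) G) =>
          ((μ.map fun p : GaugeField P j G × GaugeField P (j + 1) G => (Λ.piecewise p.2 (Φ p.1) : GaugeField P (j + 1) G)) :
            Measure (GaugeField P (j + 1) G))) (Measure.map_prod_map _ _ measurable_id hRg.measurable).symm
    _ = _ := (congrArg (fun μ : Measure (GaugeField P j G × GaugeField P (j + 1) G) =>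
          ((μ.map fun p : GaugeField P j G × GaugeField P (j + 1) G => (Λ.piecewise p.2 (Φ p.1) : GaugeField P (j + 1) G)) :
            Measure (GaugeField P (j + 1) G))) hprod).trans (map_eq_overwrite hj t ht Λ hΦ hΦΛ hΦoff ν hν).symm

end Propagate

/-! ## §2 Producers of the shear hypothesis -/
section Producers

variable {X W : Type*} [MeasurableSpace X] [MeasurableSpace W]

/-- **A density blind to the shear keeps the invariance**: `ν∘s⁻¹ = ν` and `χ∘s = χ` give `(χ·ν)∘s⁻¹ = χ·ν`. [folklore] -/
theorem map_withDensity_eq_of_map_eq {ν : Measure X} {s : X → X} (hs : Measurable s) (hν : ν.map s = ν)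
    {χ : X → ℝ≥0∞} (hχ : Measurable χ) (hχs : ∀ x, χ (s x) = χ x) :
    (ν.withDensity χ).map s = ν.withDensity χ := by
  ext A hA
  rw [Measure.map_apply hs hA, withDensity_apply _ (hs hA), withDensity_apply _ hA, ← lintegral_indicator (hs hA),
    ← lintegral_indicator hA]
  have h : (s ⁻¹' A).indicator χ = (A.indicator χ) ∘ s := by
    funext x
    by_cases hx : s x ∈ A
    · rw [Function.comp_apply, Set.indicator_of_mem (show x ∈ s ⁻¹' A from hx), Set.indicator_of_mem hx, hχs]
    · rw [Function.comp_apply, Set.indicator_of_notMem (show x ∉ s ⁻¹' A from hx), Set.indicator_of_notMem hx]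
  rw [h]
  calc ∫⁻ x, ((A.indicator χ) ∘ s) x ∂ν = ∫⁻ x, A.indicator χ x ∂(ν.map s) := (lintegral_map (hχ.indicator hA) hs).symm
    _ = ∫⁻ x, A.indicator χ x ∂ν := by rw [hν]

/-- **An event blind to the shear keeps the invariance**: `ν∘s⁻¹ = ν` and `s⁻¹E = E` give `(ν↾E)∘s⁻¹ = ν↾E`. [folklore] -/
theorem map_restrict_eq_of_map_eq {ν : Measure X} {s : X → X} (hs : Measurable s) (hν : ν.map s = ν)
    {E : Set X} (hE : MeasurableSet E) (hEs : s ⁻¹' E = E) :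
    (ν.restrict E).map s = ν.restrict E := by
  ext A hA
  rw [Measure.map_apply hs hA, Measure.restrict_apply (hs hA), Measure.restrict_apply hA]
  conv_lhs => rw [← hEs, ← Set.preimage_inter]
  rw [← Measure.map_apply hs (hA.inter hE), hν]

/-- **A pushforward intertwining the shear keeps the invariance**: if `T∘σ = s∘T` with `μ∘σ⁻¹ = μ`, then `(μ∘T⁻¹)∘s⁻¹ = μ∘T⁻¹` (the intended `σ`: the shear of the
PREVIOUS level at the last bonds of the slot segments, which the straight transporter turns into the slot shear, lit `AveragingRT.axialAvg_mul_last`). [folklore] -/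
theorem map_map_eq_of_semiconj {μ : Measure W} {T : W → X} (hT : Measurable T) {s : X → X} (hs : Measurable s)
    {σ : W → W} (hσ : Measurable σ) (hμ : μ.map σ = μ) (hcomm : ∀ w, T (σ w) = s (T w)) :
    (μ.map T).map s = μ.map T := by
  rw [Measure.map_map hs hT, show s ∘ T = T ∘ σ from funext fun w => (hcomm w).symm, ← Measure.map_map hT hσ, hμ]

variable {P : Params} {j : ℕ} {G : Type*} [GaugeGroup G] [MeasurableSpace G] [HaarData G] [MeasurableMul₂ G]

/-- **Product Haar is invariant under every masked shear** (right-invariance of Haar, factorwise). [cite: Balaban1985Averaging, (10) p.19] -/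
theorem map_shear_mask_fieldMeasure (t : PBond P (j + 1) → ℕ) (Λ : Set (PBond P (j + 1))) (k : GaugeField P (j + 1) G) :
    (fieldMeasure P j G).map
        (fun (U : GaugeField P j G) (b : PBond P j) =>
          U b * Function.extend (fun c : PBond P (j + 1) => line c (t c)) (Λ.mulIndicator k) (fun _ => 1) b) =
      fieldMeasure P j G :=
  (measurePreserving_mulRight _).map_eq

end Producers

end Summit.QuantumFields.YangMills.Theorems.UV3AxialLaunderingOverwritePropagate

end
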